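import Summits.PneNP.PneNP.Theorems.ChebyshevTracialDesignAPrioriBounds
import Summits.PneNP.PneNP.Theorems.ChebyshevTracialDesignAmplitudeOneReduction
import HarnessLib

/-!
# Cell pnp-psdrank, route `ChebyshevTracialDesign`: the FROBENIUS MASS of a degree-one Gram contraction on the `t`-slice is `≤ r·n(n−1)/(t(n−t))`,
# so CG_1 prices the amplitude class `𝒜₁` with the explicit constant: value `≤ (Σ_M ε_M₊)·r·n(n−1)/(t(n−t))` (crux `TracialDecayExp20`, stmt-PneNP-19878)

Brick 108 (prover g19; MEMO-21 §5(v), MEMO-22 §1). Brick 106 (`…AmplitudeOneReduction`) bounds the design value of `X_U = f(U)·B_UB_Uᵀ`,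
`B_U = Σ_p x_p(U)β_p`, by `(Σ_M ε_M₊)·Σ_p tr(β_pβ_pᵀ)` under CG_1. This file supplies the missing link to the dimension: if `B_UB_Uᵀ ⪯ I` on every
`t`-cut (`0 < t < n`), then `Σ_p tr(β_pβ_pᵀ) ≤ r·n(n−1)/(t(n−t))` (`≤ 16r/3` for `n/4 ≤ t ≤ n/2`). PROOF: average `tr(B_UB_Uᵀ) ≤ r` over the `t`-cuts;
`Σ_{|U|=t} tr(B_UB_Uᵀ) = Σ_{p,q} tr(β_pβ_qᵀ)·#{U ∋ p,q}`, and the `t`-cut family is 2-point homogeneous — `#{U ∋ p} = tT/n`, `#{U ∋ p,q} = t(t−1)T/(n(n−1))`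
for `p ≠ q` (`T = #t-cuts`), proved by the SWAP symmetry of brick 105 transported to cuts (`…LevelMarginals.image_*_oddSet`) and double counting —
so the sum is `(c₁−c₂)·Σ_p‖β_p‖_F² + c₂·‖Σ_pβ_p‖_F² ≥ (c₁−c₂)Σ_p‖β_p‖_F²` with `c₁ − c₂ = t(n−t)T/(n(n−1))`.
* §1 `sum_oddSet_comp_swap` (reindexing cuts by a swap), `cutCount_one_swap`, `cutCount_two_swap`, `cutCount_two_offDiag_eq` (2-point homogeneity),
  `sum_cutCount_one`, `sum_cutCount_two_row` (double counting), **`cutCount_one_eq`**, **`cutCount_two_eq`** (the two counts as fractions of `T`);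
* §2 **`frobeniusMass_le_of_contraction`** — `Σ_p tr(β_pβ_pᵀ) ≤ r·n(n−1)/(t(n−t))`;
* §3 **`value_amplitudeOne_le_of_CG1_dim`** — brick 106 + §2: `Σ W f tr(B_UB_UᵀY_M) ≤ (Σ_M ε_M₊)·(r·n(n−1)/(t(n−t)))` for contractions `B_UB_Uᵀ ⪯ I`
  (on `t`-cuts), `0 ⪯ Y_M ⪯ I`: CG_1 ⟹ the crux on `𝒜₁` with the dimension entering linearly, as the tracial normalisation `value/r` requires.
[cite: GriblingDelaatLaurent2019, §5] [cite: Rothvoss2017, §2 (PDF p. 6)] [cite: BrietDadushPokutta2014, Thm. 6 (§3)]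
Stature: support/instrument (kernel lane, no defs, axioms standard). WHAT THIS IS NOT: no proof of CG_1, no proof or refutation of `TracialDecayExp20`,
nothing on psd rank of P_PM(K_n), no P-vs-NP content. Supports stmt-PneNP-19878.
-/

set_option linter.dupNamespace false -- `Summit.PneNP.PneNP.…`: summit = sub-problem (D-0017)

noncomputable section

namespace Summit.PneNP.PneNP.Theorems.ChebyshevTracialDesignDegreeOneFrobeniusMass

open Finset Matrix Literature.Barriers.PneNP Literature.Combinatorics.Optimization
open Summit.PneNP.PneNP.Theorems.ChebyshevTracialDesignLevelMarginals (odd_card_image image_inv_image_oddSet image_image_inv_oddSet)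
open Summit.PneNP.PneNP.Theorems.ChebyshevTracialDesignAmplitudeOneReduction (value_amplitudeOne_le_of_CG1_contraction)
open Summit.PneNP.PneNP.Theorems.ChebyshevTracialDesignAPrioriBounds (trace_le_of_sub_posSemidef)
open Summit.PneNP.PneNP.Theorems.ChebyshevTracialDesignFreeBinning (trace_mul_nonneg_of_psd)

variable {n : ℕ}

/-! ### §1 The `t`-cut family is 2-point homogeneous -/

/-- Membership in the image of a cut under a swap. [folklore] -/
theorem mem_image_swap_iff (U : Finset (Fin n)) (a b x : Fin n) : x ∈ U.image (Equiv.swap a b) ↔ Equiv.swap a b x ∈ U := by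
  constructor
  · intro hx
    obtain ⟨y, hy, rfl⟩ := mem_image.1 hx
    rw [Equiv.swap_apply_self]; exact hy
  · intro hx
    exact mem_image.2 ⟨Equiv.swap a b x, hx, Equiv.swap_apply_self _ _ _⟩

/-- **Reindexing the odd sets by a swap**: `Σ_U F(σU) = Σ_U F(U)`. [folklore] -/
theorem sum_oddSet_comp_swap (a b : Fin n) (F : OddSet n → ℝ) :
    ∑ U : OddSet n, F ⟨U.1.image (Equiv.swap a b), odd_card_image _ U⟩ = ∑ U : OddSet n, F U := by
  set σ : Equiv.Perm (Fin n) := Equiv.swap a b with hσ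
  let e : OddSet n ≃ OddSet n :=
    { toFun := fun U => ⟨U.1.image σ, odd_card_image σ U⟩
      invFun := fun U => ⟨U.1.image ⇑σ⁻¹, odd_card_image σ⁻¹ U⟩
      left_inv := fun U => image_inv_image_oddSet σ U
      right_inv := fun U => image_image_inv_oddSet σ U }
  exact Equiv.sum_comp e F

/-- Swap invariance of the one-point counts: `#{t-cuts ∋ b} = #{t-cuts ∋ a}`. [folklore] -/
theorem cutCount_one_swap (t : ℕ) (a b : Fin n) :
    ∑ U : OddSet n, (if U.1.card = t then (1 : ℝ) else 0) * (if b ∈ U.1 then (1 : ℝ) else 0) =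
      ∑ U : OddSet n, (if U.1.card = t then (1 : ℝ) else 0) * (if a ∈ U.1 then (1 : ℝ) else 0) := by
  rw [← sum_oddSet_comp_swap a b (fun U => (if U.1.card = t then (1 : ℝ) else 0) * (if b ∈ U.1 then (1 : ℝ) else 0))]
  refine sum_congr rfl fun U _ => ?_
  dsimp only
  rw [card_image_of_injective _ (Equiv.injective _)]
  simp only [mem_image_swap_iff, Equiv.swap_apply_right]

/-- Swap invariance of the two-point counts: `#{t-cuts ∋ σp, σq} = #{t-cuts ∋ p, q}` for `σ = (a b)`. [folklore] -/
theorem cutCount_two_swap (t : ℕ) (a b p q : Fin n) :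
    ∑ U : OddSet n, (if U.1.card = t then (1 : ℝ) else 0) *
        ((if Equiv.swap a b p ∈ U.1 then (1 : ℝ) else 0) * (if Equiv.swap a b q ∈ U.1 then (1 : ℝ) else 0)) =
      ∑ U : OddSet n, (if U.1.card = t then (1 : ℝ) else 0) * ((if p ∈ U.1 then (1 : ℝ) else 0) * (if q ∈ U.1 then (1 : ℝ) else 0)) := by
  rw [← sum_oddSet_comp_swap a b (fun U => (if U.1.card = t then (1 : ℝ) else 0) *
    ((if Equiv.swap a b p ∈ U.1 then (1 : ℝ) else 0) * (if Equiv.swap a b q ∈ U.1 then (1 : ℝ) else 0)))]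
  refine sum_congr rfl fun U _ => ?_
  dsimp only
  rw [card_image_of_injective _ (Equiv.injective _)]
  simp only [mem_image_swap_iff, Equiv.swap_apply_self]

/-- First-argument constancy of the two-point counts off the diagonal. [folklore] -/
theorem cutCount_two_eq_of_ne (t : ℕ) {p p' q : Fin n} (hpq : p ≠ q) (hp'q : p' ≠ q) :
    ∑ U : OddSet n, (if U.1.card = t then (1 : ℝ) else 0) * ((if p ∈ U.1 then (1 : ℝ) else 0) * (if q ∈ U.1 then (1 : ℝ) else 0)) =
      ∑ U : OddSet n, (if U.1.card = t then (1 : ℝ) else 0) * ((if p' ∈ U.1 then (1 : ℝ) else 0) * (if q ∈ U.1 then (1 : ℝ) else 0)) := by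
  have h := cutCount_two_swap t p p' p q
  rw [Equiv.swap_apply_left, Equiv.swap_apply_of_ne_of_ne hpq.symm hp'q.symm] at h
  exact h.symm

/-- Symmetry of the two-point counts. [folklore] -/
theorem cutCount_two_comm (t : ℕ) (p q : Fin n) :
    ∑ U : OddSet n, (if U.1.card = t then (1 : ℝ) else 0) * ((if p ∈ U.1 then (1 : ℝ) else 0) * (if q ∈ U.1 then (1 : ℝ) else 0)) =
      ∑ U : OddSet n, (if U.1.card = t then (1 : ℝ) else 0) * ((if q ∈ U.1 then (1 : ℝ) else 0) * (if p ∈ U.1 then (1 : ℝ) else 0)) :=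
  sum_congr rfl fun U _ => by ring

/-- **2-point homogeneity**: the two-point count is the same for all pairs of distinct vertices. [folklore] -/
theorem cutCount_two_offDiag_eq (t : ℕ) {p q p₀ q₀ : Fin n} (hpq : p ≠ q) (hpq₀ : p₀ ≠ q₀) :
    ∑ U : OddSet n, (if U.1.card = t then (1 : ℝ) else 0) * ((if p ∈ U.1 then (1 : ℝ) else 0) * (if q ∈ U.1 then (1 : ℝ) else 0)) =
      ∑ U : OddSet n, (if U.1.card = t then (1 : ℝ) else 0) * ((if p₀ ∈ U.1 then (1 : ℝ) else 0) * (if q₀ ∈ U.1 then (1 : ℝ) else 0)) := by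
  by_cases h1 : p = q₀
  · subst h1
    by_cases h2 : p₀ = q
    · subst h2; exact cutCount_two_comm t p p₀
    · rw [cutCount_two_comm t p q]
      exact cutCount_two_eq_of_ne t hpq.symm hpq₀
  · calc ∑ U : OddSet n, (if U.1.card = t then (1 : ℝ) else 0) * ((if p ∈ U.1 then (1 : ℝ) else 0) * (if q ∈ U.1 then (1 : ℝ) else 0))
        = ∑ U : OddSet n, (if U.1.card = t then (1 : ℝ) else 0) * ((if q ∈ U.1 then (1 : ℝ) else 0) * (if p ∈ U.1 then (1 : ℝ) else 0)) :=
          cutCount_two_comm t p q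
      _ = ∑ U : OddSet n, (if U.1.card = t then (1 : ℝ) else 0) * ((if q₀ ∈ U.1 then (1 : ℝ) else 0) * (if p ∈ U.1 then (1 : ℝ) else 0)) :=
          cutCount_two_eq_of_ne t hpq.symm (Ne.symm h1)
      _ = ∑ U : OddSet n, (if U.1.card = t then (1 : ℝ) else 0) * ((if p ∈ U.1 then (1 : ℝ) else 0) * (if q₀ ∈ U.1 then (1 : ℝ) else 0)) :=
          cutCount_two_comm t q₀ p
      _ = _ := cutCount_two_eq_of_ne t h1 hpq₀

/-- Double counting, one point: `Σ_p #{t-cuts ∋ p} = t·T`. [folklore] -/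
theorem sum_cutCount_one (t : ℕ) :
    ∑ p : Fin n, ∑ U : OddSet n, (if U.1.card = t then (1 : ℝ) else 0) * (if p ∈ U.1 then (1 : ℝ) else 0) =
      (t : ℝ) * ((univ.filter fun U : OddSet n => U.1.card = t).card : ℝ) := by
  classical
  rw [sum_comm]
  have h : ∀ U : OddSet n, ∑ p : Fin n, (if U.1.card = t then (1 : ℝ) else 0) * (if p ∈ U.1 then (1 : ℝ) else 0) =
      if U.1.card = t then (t : ℝ) else 0 := fun U => by
    rw [← mul_sum]
    have : ∑ p : Fin n, (if p ∈ U.1 then (1 : ℝ) else 0) = (U.1.card : ℝ) := by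
      rw [← sum_filter, sum_const, nsmul_eq_mul, mul_one, filter_mem_eq_inter, univ_inter]
    rw [this]
    split_ifs with hU
    · rw [hU, one_mul]
    · rw [zero_mul]
  rw [sum_congr rfl fun U _ => h U, ← sum_filter, sum_const, nsmul_eq_mul, mul_comm]

/-- Double counting, row of the two-point counts: `Σ_q #{t-cuts ∋ p, q} = t·#{t-cuts ∋ p}`. [folklore] -/
theorem sum_cutCount_two_row (t : ℕ) (p : Fin n) :
    ∑ q : Fin n, ∑ U : OddSet n, (if U.1.card = t then (1 : ℝ) else 0) * ((if p ∈ U.1 then (1 : ℝ) else 0) * (if q ∈ U.1 then (1 : ℝ) else 0)) =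
      (t : ℝ) * ∑ U : OddSet n, (if U.1.card = t then (1 : ℝ) else 0) * (if p ∈ U.1 then (1 : ℝ) else 0) := by
  classical
  rw [sum_comm, mul_sum]
  refine sum_congr rfl fun U _ => ?_
  have : ∑ q : Fin n, (if q ∈ U.1 then (1 : ℝ) else 0) = (U.1.card : ℝ) := by
    rw [← sum_filter, sum_const, nsmul_eq_mul, mul_one, filter_mem_eq_inter, univ_inter]
  calc ∑ q : Fin n, (if U.1.card = t then (1 : ℝ) else 0) * ((if p ∈ U.1 then (1 : ℝ) else 0) * (if q ∈ U.1 then (1 : ℝ) else 0))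
      = (if U.1.card = t then (1 : ℝ) else 0) * (if p ∈ U.1 then (1 : ℝ) else 0) * ∑ q : Fin n, (if q ∈ U.1 then (1 : ℝ) else 0) := by
        rw [mul_sum]; exact sum_congr rfl fun q _ => by ring
    _ = (t : ℝ) * ((if U.1.card = t then (1 : ℝ) else 0) * (if p ∈ U.1 then (1 : ℝ) else 0)) := by
        rw [this]
        split_ifs with hU
        · rw [hU]; ring
        · ring
        · ring
        · ring

/-- **One-point count**: `#{t-cuts ∋ p} = (t/n)·T`. [folklore] -/
theorem cutCount_one_eq (hn : 0 < n) (t : ℕ) (p : Fin n) :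
    ∑ U : OddSet n, (if U.1.card = t then (1 : ℝ) else 0) * (if p ∈ U.1 then (1 : ℝ) else 0) =
      (t : ℝ) / n * ((univ.filter fun U : OddSet n => U.1.card = t).card : ℝ) := by
  have hconst : ∀ q : Fin n, ∑ U : OddSet n, (if U.1.card = t then (1 : ℝ) else 0) * (if q ∈ U.1 then (1 : ℝ) else 0) =
      ∑ U : OddSet n, (if U.1.card = t then (1 : ℝ) else 0) * (if p ∈ U.1 then (1 : ℝ) else 0) := fun q => cutCount_one_swap t p q
  have hsum := sum_cutCount_one (n := n) t
  rw [sum_congr rfl fun q _ => hconst q, sum_const, card_univ, Fintype.card_fin, nsmul_eq_mul] at hsum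
  have hnR : (n : ℝ) ≠ 0 := by exact_mod_cast hn.ne'
  field_simp
  linear_combination hsum

/-- **Two-point count**: `#{t-cuts ∋ p, q} = (t(t−1)/(n(n−1)))·T` for `p ≠ q`. [folklore] -/
theorem cutCount_two_eq (hn : 1 < n) (t : ℕ) {p q : Fin n} (hpq : p ≠ q) :
    ∑ U : OddSet n, (if U.1.card = t then (1 : ℝ) else 0) * ((if p ∈ U.1 then (1 : ℝ) else 0) * (if q ∈ U.1 then (1 : ℝ) else 0)) =
      (t : ℝ) * ((t : ℝ) - 1) / ((n : ℝ) * ((n : ℝ) - 1)) * ((univ.filter fun U : OddSet n => U.1.card = t).card : ℝ) := by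
  classical
  set T : ℝ := ((univ.filter fun U : OddSet n => U.1.card = t).card : ℝ) with hT
  set c₂ : ℝ := ∑ U : OddSet n, (if U.1.card = t then (1 : ℝ) else 0) * ((if p ∈ U.1 then (1 : ℝ) else 0) * (if q ∈ U.1 then (1 : ℝ) else 0))
    with hc₂
  have hone : ∑ U : OddSet n, (if U.1.card = t then (1 : ℝ) else 0) * (if p ∈ U.1 then (1 : ℝ) else 0) = (t : ℝ) / n * T :=
    cutCount_one_eq (by omega) t p
  have hdiag : ∑ U : OddSet n, (if U.1.card = t then (1 : ℝ) else 0) * ((if p ∈ U.1 then (1 : ℝ) else 0) * (if p ∈ U.1 then (1 : ℝ) else 0)) =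
      (t : ℝ) / n * T := by
    rw [← hone]; exact sum_congr rfl fun U _ => by split_ifs <;> ring
  -- the row sum: `(t/n)T + (n−1)c₂ = t·(t/n)T`
  have hrow := sum_cutCount_two_row (n := n) t p
  rw [hone, ← Finset.add_sum_erase univ _ (mem_univ p), hdiag] at hrow
  have hoff : ∀ q' ∈ univ.erase p, ∑ U : OddSet n, (if U.1.card = t then (1 : ℝ) else 0) *
      ((if p ∈ U.1 then (1 : ℝ) else 0) * (if q' ∈ U.1 then (1 : ℝ) else 0)) = c₂ :=
    fun q' hq' => cutCount_two_offDiag_eq t (ne_of_mem_erase hq').symm hpq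
  rw [sum_congr rfl hoff, sum_const, nsmul_eq_mul, card_erase_of_mem (mem_univ p), card_univ, Fintype.card_fin] at hrow
  have hnR : (n : ℝ) ≠ 0 := by exact_mod_cast (by omega : n ≠ 0)
  have hn1R : (n : ℝ) - 1 ≠ 0 := by
    have : (1 : ℝ) < n := by exact_mod_cast hn
    linarith
  have hcast : ((n - 1 : ℕ) : ℝ) = (n : ℝ) - 1 := by rw [Nat.cast_sub (by omega)]; simp
  rw [hcast] at hrow
  -- hrow : t/n·T + (n−1)·c₂ = t·(t/n·T)
  change c₂ = _
  have h2 : ((n : ℝ) - 1) * c₂ = (t : ℝ) * ((t : ℝ) - 1) / n * T := by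
    field_simp
    field_simp at hrow
    linear_combination hrow
  field_simp
  field_simp at h2
  linear_combination h2

/-! ### §2 The Frobenius mass of a degree-one contraction -/

/-- **FROBENIUS MASS OF A DEGREE-ONE GRAM CONTRACTION.** If `B_U = Σ_p x_p(U)·β_p` satisfies `B_UB_Uᵀ ⪯ I` on every `t`-cut, `0 < t < n`, then
`Σ_p tr(β_pβ_pᵀ) ≤ r·n(n−1)/(t(n−t))`. [cite: BrietDadushPokutta2014, Thm. 6 (§3)] [cite: Rothvoss2017, §2 (PDF p. 6)] -/
theorem frobeniusMass_le_of_contraction {r m t : ℕ} (ht0 : 0 < t) (htn : t < n)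
    (hT : 0 < (univ.filter fun U : OddSet n => U.1.card = t).card)
    (β : Fin n → Matrix (Fin r) (Fin m) ℝ)
    (hB : ∀ U : OddSet n, U.1.card = t →
      (1 - (∑ p, (if p ∈ U.1 then (1 : ℝ) else 0) • β p) * (∑ p, (if p ∈ U.1 then (1 : ℝ) else 0) • β p)ᵀ).PosSemidef) :
    ∑ p, (β p * (β p)ᵀ).trace ≤ (r : ℝ) * ((n : ℝ) * ((n : ℝ) - 1)) / ((t : ℝ) * ((n : ℝ) - t)) := by
  classical
  set T : ℝ := ((univ.filter fun U : OddSet n => U.1.card = t).card : ℝ) with hTdef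
  set x : OddSet n → Fin n → ℝ := fun U p => if p ∈ U.1 then (1 : ℝ) else 0 with hx
  set G : Fin n → Fin n → ℝ := fun p q => (β p * (β q)ᵀ).trace with hG
  -- trace of `B_UB_Uᵀ` as a double sum
  have htr : ∀ U : OddSet n, ((∑ p, x U p • β p) * (∑ p, x U p • β p)ᵀ).trace = ∑ p, ∑ q, x U p * x U q * G p q := by
    intro U
    rw [Matrix.transpose_sum, Matrix.sum_mul, Matrix.trace_sum]
    refine sum_congr rfl fun p _ => ?_
    rw [Matrix.mul_sum, Matrix.trace_sum]
    refine sum_congr rfl fun q _ => ?_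
    rw [Matrix.transpose_smul, Matrix.smul_mul, Matrix.mul_smul, Matrix.trace_smul, Matrix.trace_smul, smul_eq_mul, smul_eq_mul, hG]
    ring
  -- (1) the average of the traces is `≤ rT`
  have hsum_le : ∑ U : OddSet n, (if U.1.card = t then (1 : ℝ) else 0) * ∑ p, ∑ q, x U p * x U q * G p q ≤ (r : ℝ) * T := by
    calc ∑ U : OddSet n, (if U.1.card = t then (1 : ℝ) else 0) * ∑ p, ∑ q, x U p * x U q * G p q
        ≤ ∑ U : OddSet n, (if U.1.card = t then (r : ℝ) else 0) := by
          refine sum_le_sum fun U _ => ?_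
          by_cases hU : U.1.card = t
          · rw [if_pos hU, if_pos hU, one_mul, ← htr U]
            exact trace_le_of_sub_posSemidef (hB U hU)
          · rw [if_neg hU, if_neg hU, zero_mul]
      _ = (r : ℝ) * T := by rw [← sum_filter, sum_const, nsmul_eq_mul, mul_comm]
  -- (2) evaluate the left-hand side through the counts
  have hone : ∀ p : Fin n, ∑ U : OddSet n, (if U.1.card = t then (1 : ℝ) else 0) * (x U p * x U p) = (t : ℝ) / n * T := fun p => by
    have := cutCount_one_eq (by omega) t p
    rw [← this]
    exact sum_congr rfl fun U _ => by rw [hx]; dsimp only; split_ifs <;> ring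
  have htwo : ∀ p q : Fin n, p ≠ q → ∑ U : OddSet n, (if U.1.card = t then (1 : ℝ) else 0) * (x U p * x U q) =
      (t : ℝ) * ((t : ℝ) - 1) / ((n : ℝ) * ((n : ℝ) - 1)) * T := fun p q hpq => cutCount_two_eq (by omega) t hpq
  have hlhs : ∑ U : OddSet n, (if U.1.card = t then (1 : ℝ) else 0) * ∑ p, ∑ q, x U p * x U q * G p q =
      ∑ p, ∑ q, (∑ U : OddSet n, (if U.1.card = t then (1 : ℝ) else 0) * (x U p * x U q)) * G p q := by
    calc ∑ U : OddSet n, (if U.1.card = t then (1 : ℝ) else 0) * ∑ p, ∑ q, x U p * x U q * G p q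
        = ∑ U : OddSet n, ∑ p, ∑ q, (if U.1.card = t then (1 : ℝ) else 0) * (x U p * x U q) * G p q := by
          refine sum_congr rfl fun U _ => ?_
          rw [mul_sum]; refine sum_congr rfl fun p _ => ?_
          rw [mul_sum]; exact sum_congr rfl fun q _ => by ring
      _ = ∑ p, ∑ U : OddSet n, ∑ q, (if U.1.card = t then (1 : ℝ) else 0) * (x U p * x U q) * G p q := sum_comm
      _ = ∑ p, ∑ q, ∑ U : OddSet n, (if U.1.card = t then (1 : ℝ) else 0) * (x U p * x U q) * G p q :=
          sum_congr rfl fun p _ => sum_comm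
      _ = ∑ p, ∑ q, (∑ U : OddSet n, (if U.1.card = t then (1 : ℝ) else 0) * (x U p * x U q)) * G p q :=
          sum_congr rfl fun p _ => sum_congr rfl fun q _ => by rw [sum_mul]
  -- split diagonal / off-diagonal
  set a : ℝ := (t : ℝ) / n * T with ha
  set b : ℝ := (t : ℝ) * ((t : ℝ) - 1) / ((n : ℝ) * ((n : ℝ) - 1)) * T with hb
  have hsplit : ∑ p, ∑ q, (∑ U : OddSet n, (if U.1.card = t then (1 : ℝ) else 0) * (x U p * x U q)) * G p q =
      (a - b) * ∑ p, G p p + b * ∑ p, ∑ q, G p q := by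
    have hpq : ∀ p q : Fin n, (∑ U : OddSet n, (if U.1.card = t then (1 : ℝ) else 0) * (x U p * x U q)) * G p q =
        (if p = q then (a - b) * G p p else 0) + b * G p q := by
      intro p q
      by_cases h : p = q
      · subst h; rw [if_pos rfl, hone p]; ring
      · rw [if_neg h, htwo p q h]; ring
    simp_rw [hpq, sum_add_distrib, Finset.sum_ite_eq, if_pos (mem_univ _), ← mul_sum]
  -- the off-diagonal Gram sum is `≥ 0`: `Σ_{p,q} tr(β_pβ_qᵀ) = tr((Σβ)(Σβ)ᵀ)`
  have hGsum : 0 ≤ ∑ p, ∑ q, G p q := by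
    have e : ∑ p, ∑ q, G p q = ((∑ p, β p) * (∑ p, β p)ᵀ).trace := by
      rw [Matrix.transpose_sum, Matrix.sum_mul, Matrix.trace_sum]
      refine sum_congr rfl fun p _ => ?_
      rw [Matrix.mul_sum, Matrix.trace_sum]
    rw [e]
    have hpsd : ((∑ p, β p) * (∑ p, β p)ᵀ).PosSemidef := by
      simpa [conjTranspose_eq_transpose_of_trivial] using Matrix.posSemidef_self_mul_conjTranspose (∑ p, β p)
    exact hpsd.trace_nonneg
  have hdiag0 : 0 ≤ ∑ p, G p p := sum_nonneg fun p _ => by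
    rw [hG]; dsimp only
    have hpsd : (β p * (β p)ᵀ).PosSemidef := by
      simpa [conjTranspose_eq_transpose_of_trivial] using Matrix.posSemidef_self_mul_conjTranspose (β p)
    exact hpsd.trace_nonneg
  -- constants
  have hnR : (0 : ℝ) < n := by exact_mod_cast (show 0 < n by omega)
  have htR : (0 : ℝ) < t := by exact_mod_cast ht0
  have hntR : (0 : ℝ) < (n : ℝ) - t := by
    have : (t : ℝ) < n := by exact_mod_cast htn
    linarith
  have hn1R : (0 : ℝ) < (n : ℝ) - 1 := by
    have : (1 : ℝ) < n := by exact_mod_cast (show 1 < n by omega)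
    linarith
  have hTpos : 0 < T := by rw [hTdef]; exact_mod_cast hT
  have hb0 : 0 ≤ b := by
    rw [hb]
    refine mul_nonneg (div_nonneg (mul_nonneg htR.le ?_) (mul_nonneg hnR.le hn1R.le)) hTpos.le
    have : (1 : ℝ) ≤ t := by exact_mod_cast ht0
    linarith
  have hab : a - b = (t : ℝ) * ((n : ℝ) - t) / ((n : ℝ) * ((n : ℝ) - 1)) * T := by
    rw [ha, hb]; field_simp; ring
  have hab0 : 0 < a - b := by rw [hab]; positivity
  -- assemble: `(a − b)·Σ_p G_pp ≤ rT`
  have hkey : (a - b) * ∑ p, G p p ≤ (r : ℝ) * T := by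
    have := hsum_le
    rw [hlhs, hsplit] at this
    nlinarith [mul_nonneg hb0 hGsum]
  change ∑ p, G p p ≤ _
  set S : ℝ := ∑ p, G p p with hS
  set K : ℝ := (t : ℝ) * ((n : ℝ) - t) with hK
  set N : ℝ := (n : ℝ) * ((n : ℝ) - 1) with hN
  have hKpos : 0 < K := mul_pos htR hntR
  have hNpos : 0 < N := mul_pos hnR hn1R
  rw [hab] at hkey
  -- hkey : K / N * T * S ≤ r * T
  have h1 : K / N * S ≤ (r : ℝ) := by
    have h' : (K / N * S) * T ≤ (r : ℝ) * T := by
      calc (K / N * S) * T = K / N * T * S := by ring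
        _ ≤ (r : ℝ) * T := hkey
    exact le_of_mul_le_mul_right h' hTpos
  have h2 : K * S ≤ (r : ℝ) * N := by
    have h3 := mul_le_mul_of_nonneg_right h1 hNpos.le
    have e : K / N * S * N = K * S := by field_simp
    linarith [h3, e]
  rw [le_div_iff₀ hKpos]
  linarith [h2]

/-! ### §3 CG_1 prices the amplitude class with the explicit constant -/

/-- **CG_1 ⟹ THE CRUX ON `𝒜₁`, WITH THE DIMENSION EXPLICIT.** For any weight `W`, any mask `f`, any `t` with `0 < t < n` and some `t`-cut, any
homogeneous degree-one factor `B_U = Σ_p x_pβ_p` that is a contraction on the `t`-cuts, any psd contraction matching side `Y`, and per-matching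
bounds `Σ_U W(U,M) f(U)(Σ_p g_px_p)² ≤ ε_M Σ_p g_p²` (CG_1): `Σ_{U,M} W(U,M) f(U) tr(B_UB_UᵀY_M) ≤ (Σ_M ε_M₊)·r·n(n−1)/(t(n−t))`.
[cite: GriblingDelaatLaurent2019, §5] [cite: Rothvoss2017, §2 (PDF p. 6)] [cite: BrietDadushPokutta2014, Thm. 6 (§3)] -/
theorem value_amplitudeOne_le_of_CG1_dim {r m t : ℕ} (ht0 : 0 < t) (htn : t < n)
    (hT : 0 < (univ.filter fun U : OddSet n => U.1.card = t).card)
    (W : OddSet n → PMatch n → ℝ) (f : OddSet n → ℝ) (β : Fin n → Matrix (Fin r) (Fin m) ℝ)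
    (hB : ∀ U : OddSet n, U.1.card = t →
      (1 - (∑ p, (if p ∈ U.1 then (1 : ℝ) else 0) • β p) * (∑ p, (if p ∈ U.1 then (1 : ℝ) else 0) • β p)ᵀ).PosSemidef)
    (Y : PMatch n → Matrix (Fin r) (Fin r) ℝ) (hY : ∀ M, (Y M).PosSemidef ∧ (1 - Y M).PosSemidef) (ε : PMatch n → ℝ)
    (hCG : ∀ (M : PMatch n) (g : Fin n → ℝ),
      ∑ U : OddSet n, W U M * (f U * (∑ p, g p * (if p ∈ U.1 then (1 : ℝ) else 0)) ^ 2) ≤ ε M * ∑ p, g p ^ 2) :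
    ∑ U : OddSet n, ∑ M : PMatch n, W U M *
        (f U * ((∑ p, (if p ∈ U.1 then (1 : ℝ) else 0) • β p) * (∑ p, (if p ∈ U.1 then (1 : ℝ) else 0) • β p)ᵀ * Y M).trace) ≤
      (∑ M : PMatch n, max (ε M) 0) * ((r : ℝ) * ((n : ℝ) * ((n : ℝ) - 1)) / ((t : ℝ) * ((n : ℝ) - t))) := by
  refine (value_amplitudeOne_le_of_CG1_contraction W f β Y hY ε hCG).trans ?_
  exact mul_le_mul_of_nonneg_left (frobeniusMass_le_of_contraction ht0 htn hT β hB) (sum_nonneg fun M _ => le_max_right _ _)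

end Summit.PneNP.PneNP.Theorems.ChebyshevTracialDesignDegreeOneFrobeniusMass
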